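import Summits.Ventures.PercRepro.RankLevelSetLevelSevenRowsFortyFourToFortySeven
import Summits.Ventures.PercRepro.RankLevelSetLevelSevenRowFortyThree

/-!
# PercRepro — THE ROW `43` OF LEVEL `7`: C-025 AT `q = 7` FOR EVERY FINITE MATROID AND EVERY `p ≥ 43`, ON THE
TELESCOPING COUNT WITH THE NULLITY SPLIT IN k STEPS, THE BONFERRONI CORRECTION AT LEVEL 7 AND THE SPLIT Y-TAIL (p8, gen 21; a feeder for S4 — the top of the `q = 7` window moves from `44` to `43`)

Each row from the row above and its own rank: `c025_seven_large_<word> (P ≤ p) : RLS M p 7` is `c025_seven_at_<word>`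
(RankLevelSetLevelSevenRow<Word>) at `p = P` and the row `P + 1` above it; the row `44` is `c025_seven_large_forty_four`
(RankLevelSetLevelSevenRowsFortyFourToFortySeven). The chain reaches `43`; the literal `C025` body at `43`
(`c025_seven_forty_three`). Axioms: standard.
-/

open scoped Matroid

namespace PercRepro

namespace ThmN

variable {α : Type}

/-- **THEOREM C₇ AT `43`, UNCONDITIONAL OVER THE TREE**: every finite matroid satisfies C-025 at level `7` for every
`p ≥ 43` — the row `43` by `c025_seven_at_forty_three`, the rows `≥ 44` by `c025_seven_large_forty_four`. -/
theorem c025_seven_large_forty_three (M : Matroid α) [M.Finite] (p : ℕ) (hp : 43 ≤ p) : RLS M p 7 := by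
  rcases Nat.lt_or_ge p 44 with h | h
  · have h43 : p = 43 := by omega
    subst h43
    exact c025_seven_at_forty_three M
  · exact c025_seven_large_forty_four M p h

/-- The same in the literal `C025` body: `phiK p 7 · #U(p, 7) ≤ #Y(p, 7)` for every finite matroid and every `p ≥ 43`. -/
theorem c025_seven_forty_three (M : Matroid α) [M.Finite] (p : ℕ) (hp : 43 ≤ p) :
    phiK p 7 * ({A : Set α | A ⊆ M.E ∧ M.eRk A = (p : ℕ∞) ∧ M.eRk (M.E \ A) = (7 : ℕ∞)}.ncard : ℚ) ≤
      ({A : Set α | A ⊆ M.E ∧ (7 : ℕ∞) < M.eRk A ∧ M.eRk A < (p : ℕ∞)}.ncard : ℚ) :=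
  c025_seven_large_forty_three M p hp

end ThmN

end PercRepro
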